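import Mathlib.Analysis.Calculus.ContDiff.Operations
import Mathlib.Analysis.Calculus.ContDiff.Basic
import Mathlib.Analysis.Calculus.FDeriv.Bilinear
import Mathlib.Analysis.Calculus.FDeriv.CompCLM
import Mathlib.Data.Finset.Sort
import Mathlib.Data.Fintype.Powerset
import Mathlib.Algebra.BigOperators.Group.Finset.Powerset
import HarnessLib

/-!
# The Leibniz formula for iterated Fréchet derivatives APPLIED TO WORDS (sum over subsets of the letters)

Topic `Analysis/Calculus`; namespace `Literature.Analysis.Calculus`.  THEOREMS ONLY (no `def`, no instance, no notation, no axiom, no named fact, no `sorry`).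
Mathlib has the Leibniz BOUND `norm_iteratedFDeriv(Within)_mul_le` and the one-variable formula `iteratedDerivWithin_mul`, but no closed formula for the
`n`-th Fréchet derivative of a product evaluated on a word `m : Fin n → E`.  Here:

* `iteratedFDeriv_bilinear_apply_eq_sum_powerset` — for a continuous bilinear `B` and `f`, `g` of class `C^n` on an open set `U ∋ x`,
  `Dⁿ(B(f,g))(x)(m) = Σ_{s ⊆ Fin n} B (D^{|s|}f(x)(m|_s)) (D^{|sᶜ|}g(x)(m|_{sᶜ}))`, the sub-words read in increasing order (`Finset.orderEmbOfFin`);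
* `iteratedFDeriv_mul_apply_eq_sum_powerset` — the normed-algebra product;
* the word bookkeeping used in the induction (`iteratedFDeriv_comp_cast`, `iteratedFDeriv_orderEmbOfFin_eq`, the two `Fin.succ`-images of a subset and their complements,
  `sum_finset_fin_succ`) and the curried step `fderiv_iteratedFDeriv_apply_eq_cons`.

Proof: induction on `n`; `D^{n+1}h(x)(m) = ∂_{m₀}[y ↦ Dⁿh(y)(tail m)](x)` (`iteratedFDeriv_succ_apply_left`), the induction hypothesis near `x`, the bilinear product rule,
and the splitting of the subsets of `Fin (n+1)` according to whether they contain `0`.  Written for the (I₃-TRANSF) all-orders step of the `pub/hodgecm-mathlib` line LH3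
(crux H413, `stmt-HodgeConjecture-24833`): jumps of the jets of `u · h` along a ray, `u` smooth (`Literature/NumberTheory/Automorphic/Shelstad1979/OneSidedJumpLeibniz`).

## References
* [HormanderALPDO1] L. Hörmander, *The Analysis of Linear Partial Differential Operators I*, Springer (1983), §1.1, (1.1.8)–(1.1.9) p. 12 (Leibniz' formula).
* [Bouaziz1994IntegralesOrbitales] A. Bouaziz, *Intégrales orbitales sur les algèbres de Lie réductives*, Invent. Math. 115 (1994), §3.2 (I₁)–(I₃) pp. 579–580.
-/

open Set Filter Topology Finset Function
open scoped ContDiff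

namespace Literature.Analysis.Calculus

variable {𝕜 : Type*} [NontriviallyNormedField 𝕜] {E : Type*} [NormedAddCommGroup E] [NormedSpace 𝕜 E]
  {F : Type*} [NormedAddCommGroup F] [NormedSpace 𝕜 F] {G : Type*} [NormedAddCommGroup G] [NormedSpace 𝕜 G]
  {H : Type*} [NormedAddCommGroup H] [NormedSpace 𝕜 H]

/-! ## §1 Words: casts, increasing enumerations of subsets, the `Fin.succ`-images -/

section Words

/-- Transporting a word along an equality of orders. [cite: HormanderALPDO1, §1.1 p. 12] -/
theorem iteratedFDeriv_comp_cast {k k' : ℕ} (h : k = k') (f : E → F) (x : E) (w : Fin k' → E) :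
    iteratedFDeriv 𝕜 k f x (w ∘ Fin.cast h) = iteratedFDeriv 𝕜 k' f x w := by
  subst h; rfl

/-- The sub-word along ANY increasing enumeration of `t` is the sub-word along `t.orderEmbOfFin`. [cite: HormanderALPDO1, §1.1 p. 12] -/
theorem iteratedFDeriv_orderEmbOfFin_eq {N k : ℕ} (t : Finset (Fin N)) (hk : t.card = k) {φ : Fin k → Fin N} (hφ : StrictMono φ)
    (hφt : ∀ i, φ i ∈ t) (f : E → F) (x : E) (m : Fin N → E) :
    iteratedFDeriv 𝕜 t.card f x (m ∘ ⇑(t.orderEmbOfFin rfl)) = iteratedFDeriv 𝕜 k f x (m ∘ φ) := by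
  subst hk
  rw [Finset.orderEmbOfFin_unique rfl hφt hφ]

/-- `0` is not a successor. [cite: HormanderALPDO1, §1.1 p. 12] -/
theorem zero_not_mem_image_succ {n : ℕ} (s : Finset (Fin n)) : (0 : Fin (n + 1)) ∉ s.image Fin.succ := by
  simp [Fin.succ_ne_zero]

/-- `|s.image succ| = |s|`. [cite: HormanderALPDO1, §1.1 p. 12] -/
theorem card_image_succ {n : ℕ} (s : Finset (Fin n)) : (s.image Fin.succ).card = s.card :=
  Finset.card_image_of_injective _ (Fin.succ_injective n)

/-- `|insert 0 (s.image succ)| = |s| + 1`. [cite: HormanderALPDO1, §1.1 p. 12] -/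
theorem card_insert_zero_image_succ {n : ℕ} (s : Finset (Fin n)) : (insert 0 (s.image Fin.succ)).card = s.card + 1 := by
  rw [Finset.card_insert_of_notMem (zero_not_mem_image_succ s), card_image_succ]

/-- The complement of `s.image succ` in `Fin (n+1)` is `insert 0 (sᶜ.image succ)`. [cite: HormanderALPDO1, §1.1 p. 12] -/
theorem compl_image_succ {n : ℕ} (s : Finset (Fin n)) : (s.image Fin.succ)ᶜ = insert 0 (sᶜ.image Fin.succ) := by
  ext i
  refine Fin.cases ?_ (fun j => ?_) i
  · simp [Fin.succ_ne_zero]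
  · simp [Fin.succ_ne_zero, (Fin.succ_injective n).eq_iff]

/-- The complement of `insert 0 (s.image succ)` in `Fin (n+1)` is `sᶜ.image succ`. [cite: HormanderALPDO1, §1.1 p. 12] -/
theorem compl_insert_zero_image_succ {n : ℕ} (s : Finset (Fin n)) : (insert 0 (s.image Fin.succ))ᶜ = sᶜ.image Fin.succ := by
  ext i
  refine Fin.cases ?_ (fun j => ?_) i
  · simp [Fin.succ_ne_zero]
  · simp [Fin.succ_ne_zero, (Fin.succ_injective n).eq_iff]

/-- The sub-word of `m` along `s.image succ` is the sub-word of `tail m` along `s`. [cite: HormanderALPDO1, §1.1 p. 12] -/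
theorem iteratedFDeriv_word_image_succ {n : ℕ} (s : Finset (Fin n)) (f : E → F) (x : E) (m : Fin (n + 1) → E) :
    iteratedFDeriv 𝕜 (s.image Fin.succ).card f x (m ∘ ⇑((s.image Fin.succ).orderEmbOfFin rfl)) =
      iteratedFDeriv 𝕜 s.card f x (Fin.tail m ∘ ⇑(s.orderEmbOfFin rfl)) :=
  iteratedFDeriv_orderEmbOfFin_eq _ (card_image_succ s) (Fin.strictMono_succ.comp (s.orderEmbOfFin rfl).strictMono)
    (fun i => Finset.mem_image_of_mem _ (s.orderEmbOfFin_mem rfl i)) f x m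

/-- The sub-word of `m` along `insert 0 (s.image succ)` is `m 0` followed by the sub-word of `tail m` along `s`. [cite: HormanderALPDO1, §1.1 p. 12] -/
theorem iteratedFDeriv_word_insert_zero_image_succ {n : ℕ} (s : Finset (Fin n)) (f : E → F) (x : E) (m : Fin (n + 1) → E) :
    iteratedFDeriv 𝕜 (insert 0 (s.image Fin.succ)).card f x (m ∘ ⇑((insert 0 (s.image Fin.succ)).orderEmbOfFin rfl)) =
      iteratedFDeriv 𝕜 (s.card + 1) f x (Fin.cons (m 0) (Fin.tail m ∘ ⇑(s.orderEmbOfFin rfl))) := by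
  have hφ : StrictMono (Fin.cons (0 : Fin (n + 1)) (Fin.succ ∘ ⇑(s.orderEmbOfFin rfl)) : Fin (s.card + 1) → Fin (n + 1)) := by
    intro i j hij
    rcases Fin.eq_zero_or_eq_succ i with rfl | ⟨i', rfl⟩ <;> rcases Fin.eq_zero_or_eq_succ j with rfl | ⟨j', rfl⟩
    · exact absurd hij (lt_irrefl _)
    · simp only [Fin.cons_zero, Fin.cons_succ, Function.comp_apply]
      exact Fin.succ_pos _
    · exact absurd hij (Fin.not_lt_zero _)
    · simp only [Fin.cons_succ, Function.comp_apply]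
      exact Fin.strictMono_succ ((s.orderEmbOfFin rfl).strictMono (Fin.succ_lt_succ_iff.1 hij))
  have hmem : ∀ i, (Fin.cons (0 : Fin (n + 1)) (Fin.succ ∘ ⇑(s.orderEmbOfFin rfl)) : Fin (s.card + 1) → Fin (n + 1)) i ∈ insert 0 (s.image Fin.succ) := by
    intro i
    rcases Fin.eq_zero_or_eq_succ i with rfl | ⟨i', rfl⟩
    · simp only [Fin.cons_zero]; exact Finset.mem_insert_self _ _
    · simp only [Fin.cons_succ, Function.comp_apply]
      exact Finset.mem_insert_of_mem (Finset.mem_image_of_mem _ (s.orderEmbOfFin_mem rfl i'))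
  rw [iteratedFDeriv_orderEmbOfFin_eq _ (card_insert_zero_image_succ s) hφ hmem f x m]
  congr 1
  funext i
  rcases Fin.eq_zero_or_eq_succ i with rfl | ⟨i', rfl⟩
  · simp only [Function.comp_apply, Fin.cons_zero]
  · simp only [Function.comp_apply, Fin.cons_succ, Fin.tail]

/-- **Splitting the subsets of `Fin (n+1)` by whether they contain `0`.** [cite: HormanderALPDO1, §1.1 p. 12] -/
theorem sum_finset_fin_succ {M : Type*} [AddCommMonoid M] {n : ℕ} (T : Finset (Fin (n + 1)) → M) :
    ∑ s', T s' = ∑ s : Finset (Fin n), T (s.image Fin.succ) + ∑ s : Finset (Fin n), T (insert 0 (s.image Fin.succ)) := by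
  have h0 : (0 : Fin (n + 1)) ∉ (univ : Finset (Fin n)).image Fin.succ := zero_not_mem_image_succ _
  have huniv : (univ : Finset (Fin (n + 1))) = insert 0 ((univ : Finset (Fin n)).image Fin.succ) := by
    rw [Fin.univ_succ, Finset.cons_eq_insert, Finset.map_eq_image]
    rfl
  have hinj : ∀ a ∈ (univ : Finset (Fin n)).powerset, ∀ b ∈ (univ : Finset (Fin n)).powerset, a.image Fin.succ = b.image Fin.succ → a = b :=
    fun a _ b _ h => Finset.image_injective (Fin.succ_injective n) h
  calc ∑ s', T s' = ∑ s' ∈ (univ : Finset (Fin (n + 1))).powerset, T s' := by rw [Finset.powerset_univ]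
    _ = ∑ t ∈ ((univ : Finset (Fin n)).image Fin.succ).powerset, T t +
          ∑ t ∈ ((univ : Finset (Fin n)).image Fin.succ).powerset, T (insert 0 t) := by rw [huniv, Finset.sum_powerset_insert h0]
    _ = ∑ s : Finset (Fin n), T (s.image Fin.succ) + ∑ s : Finset (Fin n), T (insert 0 (s.image Fin.succ)) := by
          rw [Finset.powerset_image, Finset.sum_image hinj, Finset.sum_image hinj, Finset.powerset_univ]

/-- The curried step: `(D[y ↦ Dᵏf(y)](x) v)(w) = D^{k+1}f(x)(v, w)`. [cite: HormanderALPDO1, §1.1 p. 12] -/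
theorem fderiv_iteratedFDeriv_apply_eq_cons (f : E → F) (x : E) {k : ℕ} (v : E) (w : Fin k → E) :
    (fderiv 𝕜 (iteratedFDeriv 𝕜 k f) x v) w = iteratedFDeriv 𝕜 (k + 1) f x (Fin.cons v w) := by
  rw [iteratedFDeriv_succ_apply_left, Fin.cons_zero, Fin.tail_cons]

end Words

/-! ## §2 The Leibniz formula on words -/

section Leibniz

/-- **LEIBNIZ' FORMULA FOR A CONTINUOUS BILINEAR MAP, APPLIED TO A WORD.**  `U` open, `f`, `g` of class `C^n` on `U`, `x ∈ U`, `m : Fin n → E`: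
`Dⁿ(y ↦ B (f y) (g y))(x)(m) = Σ_{s ⊆ Fin n} B (D^{|s|}f(x)(m ∘ s↑)) (D^{|sᶜ|}g(x)(m ∘ sᶜ↑))` (`s↑ = s.orderEmbOfFin rfl`, the increasing enumeration).
[cite: HormanderALPDO1, §1.1 (1.1.9) p. 12] -/
theorem iteratedFDeriv_bilinear_apply_eq_sum_powerset (B : F →L[𝕜] G →L[𝕜] H) {U : Set E} (hU : IsOpen U) (n : ℕ) :
    ∀ {f : E → F} {g : E → G}, ContDiffOn 𝕜 n f U → ContDiffOn 𝕜 n g U → ∀ ⦃x : E⦄, x ∈ U → ∀ m : Fin n → E,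
      iteratedFDeriv 𝕜 n (fun y => B (f y) (g y)) x m =
        ∑ s : Finset (Fin n), B (iteratedFDeriv 𝕜 s.card f x (m ∘ ⇑(s.orderEmbOfFin rfl)))
          (iteratedFDeriv 𝕜 sᶜ.card g x (m ∘ ⇑(sᶜ.orderEmbOfFin rfl))) := by
  induction n with
  | zero =>
    intro f g hf hg x hx m
    rw [Fintype.sum_eq_single (∅ : Finset (Fin 0)) (fun s hs => absurd (Finset.eq_empty_of_isEmpty s) hs)]
    have h1 : iteratedFDeriv 𝕜 (∅ : Finset (Fin 0)).card f x (m ∘ ⇑((∅ : Finset (Fin 0)).orderEmbOfFin rfl)) = f x :=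
      iteratedFDeriv_zero_apply _
    have h2 : iteratedFDeriv 𝕜 (∅ : Finset (Fin 0))ᶜ.card g x (m ∘ ⇑((∅ : Finset (Fin 0))ᶜ.orderEmbOfFin rfl)) = g x := by
      rw [Finset.eq_empty_of_isEmpty ((∅ : Finset (Fin 0))ᶜ)]
      exact iteratedFDeriv_zero_apply _
    rw [iteratedFDeriv_zero_apply, h1, h2]
  | succ n ih =>
    intro f g hf hg x hx m
    have hle : ((n : ℕ) : WithTop ℕ∞) ≤ ((n + 1 : ℕ) : WithTop ℕ∞) := by exact_mod_cast Nat.le_succ n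
    have hfn : ContDiffOn 𝕜 n f U := hf.of_le hle
    have hgn : ContDiffOn 𝕜 n g U := hg.of_le hle
    have hxU : U ∈ 𝓝 x := hU.mem_nhds hx
    have hBfg : ContDiffOn 𝕜 (n + 1 : ℕ) (fun y => B (f y) (g y)) U :=
      B.isBoundedBilinearMap.contDiff.comp_contDiffOn (hf.prodMk hg)
    -- `D^{n+1}h(x)(m) = ∂_{m 0} [y ↦ Dⁿh(y)(tail m)] (x)`
    rw [iteratedFDeriv_succ_apply_left]
    have hD : DifferentiableAt 𝕜 (iteratedFDeriv 𝕜 n (fun y => B (f y) (g y))) x :=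
      (hBfg.contDiffAt hxU).differentiableAt_iteratedFDeriv (by exact_mod_cast Nat.lt_succ_self n)
    rw [← fderiv_continuousMultilinear_apply_const_apply hD (Fin.tail m) (m 0)]
    -- the induction hypothesis near `x`
    have hIH : (fun y => iteratedFDeriv 𝕜 n (fun y => B (f y) (g y)) y (Fin.tail m)) =ᶠ[𝓝 x]
        fun y => ∑ s : Finset (Fin n), B (iteratedFDeriv 𝕜 s.card f y (Fin.tail m ∘ ⇑(s.orderEmbOfFin rfl)))
          (iteratedFDeriv 𝕜 sᶜ.card g y (Fin.tail m ∘ ⇑(sᶜ.orderEmbOfFin rfl))) :=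
      Filter.eventually_of_mem hxU fun y hy => ih hfn hgn hy (Fin.tail m)
    rw [hIH.fderiv_eq]
    -- differentiate the sum termwise (bilinear product rule; the factors are jets of order `≤ n < n + 1`)
    have hDf : ∀ s : Finset (Fin n), DifferentiableAt 𝕜 (iteratedFDeriv 𝕜 s.card f) x := fun s =>
      (hf.contDiffAt hxU).differentiableAt_iteratedFDeriv
        (by exact_mod_cast Nat.lt_succ_of_le ((Finset.card_le_univ s).trans (Fintype.card_fin n).le))
    have hDg : ∀ s : Finset (Fin n), DifferentiableAt 𝕜 (iteratedFDeriv 𝕜 s.card g) x := fun s =>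
      (hg.contDiffAt hxU).differentiableAt_iteratedFDeriv
        (by exact_mod_cast Nat.lt_succ_of_le ((Finset.card_le_univ s).trans (Fintype.card_fin n).le))
    have hderiv : HasFDerivAt (fun y => ∑ s : Finset (Fin n), B (iteratedFDeriv 𝕜 s.card f y (Fin.tail m ∘ ⇑(s.orderEmbOfFin rfl)))
          (iteratedFDeriv 𝕜 sᶜ.card g y (Fin.tail m ∘ ⇑(sᶜ.orderEmbOfFin rfl))))
        (∑ s : Finset (Fin n),
          (B.precompR E (iteratedFDeriv 𝕜 s.card f x (Fin.tail m ∘ ⇑(s.orderEmbOfFin rfl)))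
              ((fderiv 𝕜 (iteratedFDeriv 𝕜 sᶜ.card g) x).flipMultilinear (Fin.tail m ∘ ⇑(sᶜ.orderEmbOfFin rfl))) +
            B.precompL E ((fderiv 𝕜 (iteratedFDeriv 𝕜 s.card f) x).flipMultilinear (Fin.tail m ∘ ⇑(s.orderEmbOfFin rfl)))
              (iteratedFDeriv 𝕜 sᶜ.card g x (Fin.tail m ∘ ⇑(sᶜ.orderEmbOfFin rfl))))) x :=
      HasFDerivAt.fun_sum fun s _ => B.hasFDerivAt_of_bilinear ((hDf s).hasFDerivAt.continuousMultilinear_apply_const _)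
        ((hDg sᶜ).hasFDerivAt.continuousMultilinear_apply_const _)
    rw [hderiv.fderiv, FunLike.coe_sum, Finset.sum_apply, sum_finset_fin_succ, ← Finset.sum_add_distrib]
    refine Finset.sum_congr rfl fun s _ => ?_
    rw [add_apply, ContinuousLinearMap.precompL_apply, ContinuousLinearMap.flipMultilinear_apply_apply,
      fderiv_iteratedFDeriv_apply_eq_cons]
    rw [show (B.precompR E (iteratedFDeriv 𝕜 s.card f x (Fin.tail m ∘ ⇑(s.orderEmbOfFin rfl)))
          ((fderiv 𝕜 (iteratedFDeriv 𝕜 sᶜ.card g) x).flipMultilinear (Fin.tail m ∘ ⇑(sᶜ.orderEmbOfFin rfl)))) (m 0) =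
        B (iteratedFDeriv 𝕜 s.card f x (Fin.tail m ∘ ⇑(s.orderEmbOfFin rfl)))
          (iteratedFDeriv 𝕜 (sᶜ.card + 1) g x (Fin.cons (m 0) (Fin.tail m ∘ ⇑(sᶜ.orderEmbOfFin rfl)))) by
      rw [← fderiv_iteratedFDeriv_apply_eq_cons]; rfl]
    rw [compl_image_succ s, compl_insert_zero_image_succ s, iteratedFDeriv_word_image_succ, iteratedFDeriv_word_insert_zero_image_succ,
      iteratedFDeriv_word_insert_zero_image_succ, iteratedFDeriv_word_image_succ]

/-- **LEIBNIZ' FORMULA FOR A PRODUCT IN A NORMED ALGEBRA, APPLIED TO A WORD**: `U` open, `f`, `g` of class `C^n` on `U`, `x ∈ U`: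
`Dⁿ(f·g)(x)(m) = Σ_{s ⊆ Fin n} D^{|s|}f(x)(m ∘ s↑) · D^{|sᶜ|}g(x)(m ∘ sᶜ↑)`. [cite: HormanderALPDO1, §1.1 (1.1.9) p. 12] -/
theorem iteratedFDeriv_mul_apply_eq_sum_powerset {𝔸 : Type*} [NormedRing 𝔸] [NormedAlgebra 𝕜 𝔸] {U : Set E} (hU : IsOpen U) (n : ℕ)
    {f g : E → 𝔸} (hf : ContDiffOn 𝕜 n f U) (hg : ContDiffOn 𝕜 n g U) {x : E} (hx : x ∈ U) (m : Fin n → E) :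
    iteratedFDeriv 𝕜 n (fun y => f y * g y) x m =
      ∑ s : Finset (Fin n), iteratedFDeriv 𝕜 s.card f x (m ∘ ⇑(s.orderEmbOfFin rfl)) * iteratedFDeriv 𝕜 sᶜ.card g x (m ∘ ⇑(sᶜ.orderEmbOfFin rfl)) := by
  have h := iteratedFDeriv_bilinear_apply_eq_sum_powerset (ContinuousLinearMap.mul 𝕜 𝔸) hU n hf hg hx m
  simp only [ContinuousLinearMap.mul_apply'] at h
  exact h

/-- **LEIBNIZ' FORMULA FOR A SCALAR MULTIPLE, APPLIED TO A WORD**: `Dⁿ(f • g)(x)(m) = Σ_{s ⊆ Fin n} D^{|s|}f(x)(m ∘ s↑) • D^{|sᶜ|}g(x)(m ∘ sᶜ↑)` for `f`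
scalar-valued and `g` vector-valued. [cite: HormanderALPDO1, §1.1 (1.1.9) p. 12] -/
theorem iteratedFDeriv_smul_apply_eq_sum_powerset {U : Set E} (hU : IsOpen U) (n : ℕ)
    {f : E → 𝕜} {g : E → F} (hf : ContDiffOn 𝕜 n f U) (hg : ContDiffOn 𝕜 n g U) {x : E} (hx : x ∈ U) (m : Fin n → E) :
    iteratedFDeriv 𝕜 n (fun y => f y • g y) x m =
      ∑ s : Finset (Fin n), iteratedFDeriv 𝕜 s.card f x (m ∘ ⇑(s.orderEmbOfFin rfl)) • iteratedFDeriv 𝕜 sᶜ.card g x (m ∘ ⇑(sᶜ.orderEmbOfFin rfl)) := by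
  have h := iteratedFDeriv_bilinear_apply_eq_sum_powerset (ContinuousLinearMap.lsmul 𝕜 𝕜 : 𝕜 →L[𝕜] F →L[𝕜] F) hU n hf hg hx m
  simp only [ContinuousLinearMap.lsmul_apply] at h
  exact h

end Leibniz

/-! ## ED. 2 — counting letters on complementary sub-words (append-only; ED. 1 statements byte-identical) -/

section Count

/-- The letters of the sub-word along `s↑` equal to `a` are counted by `s.filter`. [cite: HormanderALPDO1, §1.1 p. 12] -/
theorem card_filter_subword_eq {α : Type*} [DecidableEq α] {N : ℕ} (s : Finset (Fin N)) (m : Fin N → α) (a : α) :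
    (Finset.univ.filter fun r : Fin s.card => (m ∘ ⇑(s.orderEmbOfFin rfl)) r = a).card = (s.filter fun i => m i = a).card := by
  classical
  have hinj : Function.Injective ⇑(s.orderEmbOfFin rfl) := (s.orderEmbOfFin rfl).injective
  have himg : (Finset.univ.filter fun r : Fin s.card => (m ∘ ⇑(s.orderEmbOfFin rfl)) r = a).image ⇑(s.orderEmbOfFin rfl) =
      s.filter fun i => m i = a := by
    ext i
    simp only [Finset.mem_image, Finset.mem_filter, Finset.mem_univ, true_and, Function.comp_apply]
    constructor
    · rintro ⟨r, hr, rfl⟩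
      exact ⟨s.orderEmbOfFin_mem rfl r, hr⟩
    · rintro ⟨hi, hmi⟩
      have hr : i ∈ Set.range ⇑(s.orderEmbOfFin rfl) := by rw [Finset.range_orderEmbOfFin]; exact hi
      obtain ⟨r, rfl⟩ := hr
      exact ⟨r, hmi, rfl⟩
  rw [← himg, Finset.card_image_of_injective _ hinj]

/-- **LETTER COUNTS SPLIT OVER COMPLEMENTARY SUB-WORDS**: `#{r | (m ∘ s↑) r = a} + #{r | (m ∘ sᶜ↑) r = a} = #{r | m r = a}` (e.g. the number of normal letters of a
word is the sum over the two halves of a Leibniz term). [cite: HormanderALPDO1, §1.1 (1.1.9) p. 12] -/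
theorem card_filter_subword_add_compl {α : Type*} [DecidableEq α] {N : ℕ} (s : Finset (Fin N)) (m : Fin N → α) (a : α) :
    (Finset.univ.filter fun r : Fin s.card => (m ∘ ⇑(s.orderEmbOfFin rfl)) r = a).card +
      (Finset.univ.filter fun r : Fin sᶜ.card => (m ∘ ⇑(sᶜ.orderEmbOfFin rfl)) r = a).card =
      (Finset.univ.filter fun r : Fin N => m r = a).card := by
  classical
  rw [card_filter_subword_eq, card_filter_subword_eq, ← Finset.card_union_of_disjoint (Finset.disjoint_filter_filter disjoint_compl_right),
    ← Finset.filter_union, Finset.union_compl]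

/-- If no letter of the sub-word along `s↑` equals `a`, the complementary sub-word carries all of them. [cite: HormanderALPDO1, §1.1 p. 12] -/
theorem card_filter_subword_compl_eq_of_eq_zero {α : Type*} [DecidableEq α] {N : ℕ} (s : Finset (Fin N)) (m : Fin N → α) (a : α)
    (h : (Finset.univ.filter fun r : Fin s.card => (m ∘ ⇑(s.orderEmbOfFin rfl)) r = a).card = 0) :
    (Finset.univ.filter fun r : Fin sᶜ.card => (m ∘ ⇑(sᶜ.orderEmbOfFin rfl)) r = a).card = (Finset.univ.filter fun r : Fin N => m r = a).card := by
  have h2 := card_filter_subword_add_compl s m a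
  rw [h, zero_add] at h2
  exact h2

end Count

end Literature.Analysis.Calculus
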